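import Summits.Schanuel.Schanuel.Theorems.RootDecomp1BAlgFrame09
import Summits.Schanuel.Schanuel.Theorems.RootDecomp1KHyper47

/-!
# RootDecomp1BResFrame — lens 4, generation 45 «RESULTANT CLEARING: t(1, ρ) = 5 IN EVERY DEGREE» (lane (d) of B-R26/B-R31 (ii); CHECKLIST B-g41 L2128 taken up verbatim, CLAIM L2306, ACK L2307, NODE ≈L2316–L2319; critic VERDICT pending at staging — filed only on GO) — part 1 (RootDecomp1BResFrame01): §D class + §A plumbing + §B Leibniz/Sylvester bounds

(lens-4 g45 HOME kernel K = HOME/decomp-schanuel-lens-4/g45/ResFrame.lean 9524d315…, 978 l, imports tree `…RootDecomp1BAlgFrame09` + `…RootDecomp1KHyper47`; P ResFrameProbe.lean, C ResFrameCtrl.lean (rc 1 = 17 planted), NODE-g45.md. Port by census-1 gen 19 as `RootDecomp1BResFrame01–04`: 01 = §D the class `AlgUltraLiouvilleIrr` (β ≠ ρ, f irreducible over ℚ, unbounded degree, rate exp(−exp(A^m))) + `algUltraLiouville_sqrt_two` + §A plumbing (first-variable splitting `finSuccEquiv` over ℤ) + §B column-wise Leibniz bounds / Sylvester matrix (`resultant_bounds_cols`);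 02 = §E0 the resultant `resX0` eliminating X₀ (`aeval_resX0`, `resX0_ne_zero` via `aeval_eq_zero_of_conj_irrQ`, `resX0_bounds`) + §R growth (`kappa1`, `royC_le_exp`, `endgame₄₀`, `Gamma`); 03 = §E THE ENGINE `algebraicIndependent_cons_of_algUltraIrr (hRoy : Roy2014_thm_1_1) (hρ : AlgUltraLiouvilleIrr ρ) : AlgebraicIndependent ℚ (ρ, e, e^ρ, e^i, e^{iρ})` (scoped `maxHeartbeats 1600000` as in K); 04 = §C cells `five_le_polarDeg_one_of_algUltraIrr (hRoy) (hρ) : ((5 : ℕ) : Cardinal) ≤ polarDeg ![(1 : ℝ), ρ]`, swap, surplus/KleinPolar bodies, the four At-cells + §M the named member: `irreducible_fSeq_map`, `algUltraLiouvilleIrr_rhoA` HYP-FREE, `five_le_polarDeg_one_rhoA (hRoy)`, `rhoA_position_irr` — mod `Roy2014_thm_1_1` ONLY (registered, unproved ⇒ binder stays).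
PORT EDITS: the class def's docstring tagged «[class] definition …»; three generic helpers private (`mem_roots_map_iff` — known dedup twin —, `ringHom_mvaeval_int`, `coeff_map_algebraMap_mv`) with per-part private copies; four one-line docstrings added; linter option dropped; statements and proofs verbatim. `--supports stmt-Schanuel-24622`; no census credit carried; rung 0 — nothing here proves Schanuel.)
-/

/-!
# ResFrame — lens 4, generation 45: «RESULTANT CLEARING — t(1, ρ) = 5 in EVERY degree»
(lane (d) of RULE B-R26 / B-R31: «t(1, ρ) ≥ 5 beyond the quadratic class — first-variable clearing in degree > 2»;
CHECKLIST B-g41, bus L2128; CLAIM of g45, bus L2307)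

HEADER — see NODE-g45.md for §0 (honest scope), the presearch and the identity sentence.  In one paragraph:

* CLASS `AlgUltraLiouvilleIrr ρ` (§D): for every level `m` a real algebraic IRRATIONAL `β ≠ ρ`, root of an integer
  polynomial `f` IRREDUCIBLE over `ℚ` with `deg f ≤ A`, naive height `≤ A`, `A ≥ m`, and `|ρ − β| < exp(−exp(A^m))`.
  Sub-class of g40's `AlgUltraLiouville` (tree `RootDecomp1BAlgFrame01`); the two extra conjuncts `β ≠ ρ`,
  `Irreducible` are exactly what the fifth variable costs (`algUltraLiouville_sqrt_two`: `√2 ∈ AlgUltraLiouville` with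
  `β = √2` at every level, where `t(1, √2) = 4`).
* ENGINE (§E, g16's resultant engine transplanted 1K → 1B + g40's budget at GROWING degree): a relation
  `P(ρ, e, e^ρ, e^i, e^{iρ}) = 0`, `P ∈ ℤ[X₀..X₄]`, is cleared of the approximated coordinate `X₀ = ρ ≈ β` by the
  RESULTANT `N := Res_{X₀}(f, P) ∈ ℤ[X₁..X₄]` (`resX0`, Mathlib `Polynomial.resultant` over `ℤ[X₁..X₄]` applied to
  `MvPolynomial.finSuccEquiv ℤ 4 P`): `N(θ) = lead(f)^{D₀} ∏_{f(γ)=0} P(γ, θ)` (`aeval_resX0`), `N ≠ 0`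
  (`resX0_ne_zero`: irreducibility + conjugation + the tree's grouped coefficient `gcoef` non-vanishing on the
  punctured ball, where `β ≠ ρ` enters), `deg N ≤ d·D`, `len N ≤ (d + D₀)!·L^d·A^{D₀}` (`resX0_bounds`, column-wise
  Leibniz); at `θ_β = (e, e^β, e^i, e^{iβ})` the `β`-factor is `≤ Kl·exp(−exp(A^m))` (tree Lipschitz), the conjugate
  factors are bounded by the house `‖γ‖ ≤ A + 1`; the FLOOR is g40's `algFrameMeasure_explicit_of_roy hRoy (d * D)`
  at the SAME frame, whose constant `royC (d·D)` grows like `exp(κ₁ (dD+1)^{40})` (`royC_le_exp`, closed form) —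
  the class rate at level `m = 41 + k`, `2^k > c(P, ρ)`, wins (`endgame₄₀`).
* CELLS (§C): `five_le_polarDeg_of_algUltraIrr (hRoy)` = the tree text of `RootDecomp1BQuadFrame05` l.35/53/59 with
  `QuadHyperLiouville ↦ AlgUltraLiouvilleIrr` and nothing else; MEMBER (§M): g40's `ρ_A` is in the class
  HYPOTHESIS-FREE (`algUltraLiouvilleIrr_rhoA`), so `t(1, ρ_A) = 5` mod Roy (`five_le_polarDeg_one_rhoA`) at a point
  outside every bounded-degree class of record (`rhoA_position`, tree).

`hRoy : Roy2014_thm_1_1` is the ONLY fact binder.  Nothing here proves Schanuel; no ∀-item of RootDecomp1B moves;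
rung 0.
-/

noncomputable section

open Complex IntermediateField MvPolynomial

namespace Summit.Schanuel.Schanuel.Theorems.RootDecomp1BResFrame

open Summit.Schanuel.Schanuel.Theorems.RootDecomp1EPointTransfer (Roy2014_thm_1_1)
open Summit.Schanuel.Schanuel.Theorems.RootDecomp1KHyper (mvlen mvlen_nonneg abs_coeff_le_mvlen one_le_mvlen
  exists_ball_eval_ne_zero mvlen_add_le mvlen_mul_le mvlen_C_mul_le mvlen_sum_le mvlen_prod_le mvlen_C mvlen_zero)
open Summit.Schanuel.Schanuel.Theorems.RootDecomp1BHyperFrame (royS framePt Ff Ff_eq_aeval exists_lipschitz_Ff gcoef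
  gcoef_ne_zero apply_zero_le_totalDegree linearIndependent_one_irrational)
open Summit.Schanuel.Schanuel.Theorems.RootDecomp1BQuadFrame (qy qe qpt qpt_apply framePt_qy_qe linearIndependent_qpt
  QuadHyperLiouville norm_exp_qpt_le)
open Summit.Schanuel.Schanuel.Theorems.RootDecomp1BAlgFrame
open Summit.Schanuel.Schanuel.Theorems.RootDecomp1BFedFlagCore (KleinIH polarDeg polarField)
open Summit.Schanuel.Schanuel.Theorems.RootDecomp1BDefectFloorDefs (SharpRelativeLindemannAt TameDefectZeroAt
  WildSharpDefectZeroAt WildSharpDefectZeroInitAt WildSharpInitAt)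
open Summit.Schanuel.Schanuel.Theorems.RootDecomp1BDefectFloorCells (natCast_le_trdeg_of_algebraicIndependent)
open Summit.Schanuel.Schanuel.Theorems.RootDecomp1BRadicalDescent (exists_int_relation norm_mvaeval_le_mvlen)
open Summit.Schanuel.Schanuel.Theorems.RootDecomp1BMovingZero (mem_polarField_one mem_polarField_swap)

/-! ## §D  The class `AlgUltraLiouvilleIrr` -/

section Defs

/-- [class] definition (membership predicate with parameters, NOT a fact; census convention): **THE CLASS `AlgUltraLiouvilleIrr`** (CHECKLIST B-g41 (1), character for character): for every `m` a real
algebraic IRRATIONAL `β ≠ ρ`, root of an `f ∈ ℤ[X]` IRREDUCIBLE OVER `ℚ` whose degree and naive height are bounded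
only by the level datum `A ≥ m`, with `|ρ − β| < exp(−exp(A^m))`.  `β ≠ ρ` and `Irreducible` are LOAD-BEARING for
`t(1, ρ) = 5` (see `algUltraLiouville_sqrt_two` and the control file). -/
def AlgUltraLiouvilleIrr (ρ : ℝ) : Prop :=
  ∀ m : ℕ, ∃ (β : ℝ) (f : Polynomial ℤ) (A : ℕ), m ≤ A ∧ Irrational β ∧
    Irreducible (f.map (Int.castRingHom ℚ)) ∧ f.natDegree ≤ A ∧ (∀ i, |f.coeff i| ≤ (A : ℤ)) ∧
    Polynomial.aeval β f = 0 ∧ β ≠ ρ ∧ |ρ - β| < Real.exp (-Real.exp ((A : ℝ) ^ m))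

/-- The one-line inclusion into g40's class (so every g40 cell applies). -/
theorem AlgUltraLiouvilleIrr.algUltraLiouville {ρ : ℝ} (h : AlgUltraLiouvilleIrr ρ) : AlgUltraLiouville ρ := by
  intro m
  obtain ⟨β, f, A, hmA, hirr, hfirr, hdeg, hA, hfβ, -, hlt⟩ := h m
  exact ⟨β, f, A, hmA, hirr, fun hf => hfirr.ne_zero (by rw [hf, Polynomial.map_zero]), hdeg, hA, hfβ, hlt⟩

/-- **POSITIVE WITNESS** that `β ≠ ρ` is load-bearing: `√2 ∈ AlgUltraLiouville` (g40's class AS DEFINED), with the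
constant approximant `β = √2`, `f = X² − 2` at every level — and `t(1, √2) = 4` by Lindemann–Weierstrass, so no
`t = 5` theorem can hold on `AlgUltraLiouville`. -/
theorem algUltraLiouville_sqrt_two : AlgUltraLiouville (Real.sqrt 2) := by
  intro m
  refine ⟨Real.sqrt 2, Polynomial.X ^ 2 - Polynomial.C 2, m + 2, by omega, irrational_sqrt_two, ?_, ?_, ?_, ?_, ?_⟩
  · intro h
    have := congrArg (fun p : Polynomial ℤ => p.coeff 0) h
    simp at this
  · have h : (Polynomial.X ^ 2 - Polynomial.C (2 : ℤ)).natDegree ≤ 2 := by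
      refine (Polynomial.natDegree_sub_le _ _).trans ?_
      simp
    omega
  · intro i
    rw [Polynomial.coeff_sub, Polynomial.coeff_X_pow, Polynomial.coeff_C]
    split_ifs <;> norm_num <;> omega
  · have h2 : Real.sqrt 2 ^ 2 = 2 := Real.sq_sqrt (by norm_num)
    rw [map_sub, map_pow, Polynomial.aeval_X, Polynomial.aeval_C, h2, algebraMap_int_eq, eq_intCast]
    norm_num
  · rw [sub_self, abs_zero]; exact Real.exp_pos _

end Defs

/-! ## §A  Plumbing: the first-variable splitting `finSuccEquiv` over `ℤ`, lengths and degrees of its coefficients -/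

section Plumbing

variable {n : ℕ}

/-- `cons i` is injective on exponent vectors. -/
private theorem cons_injective_RF (i : ℕ) : Function.Injective (Finsupp.cons i : (Fin n →₀ ℕ) → (Fin (n + 1) →₀ ℕ)) :=
  fun a b h => by simpa [Finsupp.tail_cons] using congrArg Finsupp.tail h

/-- Each `X₀`-coefficient of `P` (a polynomial in `X₁..Xₙ`) has length `≤ len P`. -/
theorem mvlen_coeff_finSuccEquiv_le (P : MvPolynomial (Fin (n + 1)) ℤ) (i : ℕ) :
    mvlen ((finSuccEquiv ℤ n P).coeff i) ≤ mvlen P := by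
  classical
  unfold mvlen
  have h1 : ∑ m ∈ ((finSuccEquiv ℤ n P).coeff i).support, |((finSuccEquiv ℤ n P).coeff i).coeff m| =
      ∑ s ∈ ((finSuccEquiv ℤ n P).coeff i).support.image (Finsupp.cons i), |P.coeff s| := by
    rw [Finset.sum_image (fun a _ b _ h => cons_injective_RF i h)]
    exact Finset.sum_congr rfl fun m _ => by rw [finSuccEquiv_coeff_coeff]
  rw [h1, image_support_finSuccEquiv]
  exact Finset.sum_le_sum_of_subset_of_nonneg (Finset.filter_subset _ _) fun _ _ _ => abs_nonneg _

/-- Each `X₀`-coefficient of `P` has total degree `≤ deg P`. -/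
theorem totalDegree_coeff_finSuccEquiv_le (P : MvPolynomial (Fin (n + 1)) ℤ) (i : ℕ) :
    ((finSuccEquiv ℤ n P).coeff i).totalDegree ≤ P.totalDegree := by
  by_cases hi : (finSuccEquiv ℤ n P).coeff i = 0
  · rw [hi, totalDegree_zero]; exact Nat.zero_le _
  · exact le_trans (Nat.le_add_right _ _) (totalDegree_coeff_finSuccEquiv_add_le P i hi)

/-- The `X₀`-degree is at most the total degree. -/
theorem natDegree_finSuccEquiv_le (P : MvPolynomial (Fin (n + 1)) ℤ) :
    (finSuccEquiv ℤ n P).natDegree ≤ P.totalDegree := by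
  rw [natDegree_finSuccEquiv]; exact degreeOf_le_totalDegree P 0

/-- `finSuccEquiv` commutes with the coefficient map `ℤ → ℂ`. -/
theorem finSuccEquiv_map_castC (P : MvPolynomial (Fin (n + 1)) ℤ) :
    finSuccEquiv ℂ n (MvPolynomial.map (Int.castRingHom ℂ) P) =
      (finSuccEquiv ℤ n P).map (MvPolynomial.map (Int.castRingHom ℂ)) := by
  refine Polynomial.ext fun i => MvPolynomial.ext _ _ fun m => ?_
  rw [finSuccEquiv_coeff_coeff, coeff_map, Polynomial.coeff_map, coeff_map, finSuccEquiv_coeff_coeff]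

/-- A ring hom out of `ℂ`-valued evaluation: `ψ (aeval g P) = aeval (ψ ∘ g) P` for integer `P`. -/
private theorem ringHom_mvaeval_int {S T : Type*} [CommRing S] [CommRing T] (ψ : S →+* T) {σ : Type*} (g : σ → S)
    (P : MvPolynomial σ ℤ) : ψ (aeval g P) = aeval (fun i => ψ (g i)) P := by
  rw [MvPolynomial.aeval_def, MvPolynomial.aeval_def, MvPolynomial.eval₂_comp_left]
  congr 1
  exact RingHom.ext_int _ _

/-- **Evaluation along the first variable**: `P(γ, θ) = (P̂.map (aeval θ)).eval γ`, `P̂ = finSuccEquiv ℤ n P`. -/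
theorem aeval_cons_eq_eval_finSuccEquiv (P : MvPolynomial (Fin (n + 1)) ℤ) (θ : Fin n → ℂ) (γ : ℂ) :
    aeval (Fin.cons γ θ : Fin (n + 1) → ℂ) P =
      ((finSuccEquiv ℤ n P).map (MvPolynomial.aeval θ).toRingHom).eval γ := by
  have h1 : aeval (Fin.cons γ θ : Fin (n + 1) → ℂ) P =
      eval (Fin.cons γ θ : Fin (n + 1) → ℂ) (MvPolynomial.map (Int.castRingHom ℂ) P) := by
    rw [eval_map, MvPolynomial.aeval_def, algebraMap_int_eq]
  have h2 : (MvPolynomial.aeval θ).toRingHom =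
      (eval θ).comp (MvPolynomial.map (Int.castRingHom ℂ) :
        MvPolynomial (Fin n) ℤ →+* MvPolynomial (Fin n) ℂ) := by
    refine MvPolynomial.ringHom_ext (fun r => ?_) (fun i => ?_)
    · simp
    · simp
  rw [h1, eval_eq_eval_mv_eval', finSuccEquiv_map_castC, Polynomial.map_map, h2]

end Plumbing

/-! ## §B  Column-wise Leibniz bounds for determinants over `ℤ[x⃗]` and the Sylvester matrix -/

section Leibniz

variable {n : ℕ}

/-- Integer casts into `MvPolynomial (Fin n) ℤ` are constants. -/
private theorem intCast_eq_C_RF (k : ℤ) : ((k : ℤ) : MvPolynomial (Fin n) ℤ) = MvPolynomial.C k := by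
  rw [← map_intCast (MvPolynomial.C : ℤ →+* MvPolynomial (Fin n) ℤ) k, Int.cast_id]

/-- **Leibniz bound, column by column**: an `N × N` determinant whose `j`-th column has entries of length `≤ B j`
has length `≤ N!·∏ B j`. -/
theorem mvlen_det_le_cols {N : ℕ} (M : Matrix (Fin N) (Fin N) (MvPolynomial (Fin n) ℤ)) (B : Fin N → ℤ)
    (hM : ∀ i j, mvlen (M i j) ≤ B j) : mvlen M.det ≤ (Nat.factorial N : ℤ) * ∏ j, B j := by
  rw [Matrix.det_apply']
  refine (mvlen_sum_le _ _).trans ?_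
  have hσ : ∀ σ : Equiv.Perm (Fin N),
      mvlen (((Equiv.Perm.sign σ : ℤ) : MvPolynomial (Fin n) ℤ) * ∏ i, M (σ i) i) ≤ ∏ j, B j := by
    intro σ
    rw [intCast_eq_C_RF]
    have habs : |((Equiv.Perm.sign σ : ℤˣ) : ℤ)| = 1 := Int.isUnit_iff_abs_eq.mp (Units.isUnit _)
    calc mvlen (MvPolynomial.C ((Equiv.Perm.sign σ : ℤˣ) : ℤ) * ∏ i, M (σ i) i)
        ≤ |((Equiv.Perm.sign σ : ℤˣ) : ℤ)| * mvlen (∏ i, M (σ i) i) := mvlen_C_mul_le _ _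
      _ = mvlen (∏ i, M (σ i) i) := by rw [habs, one_mul]
      _ ≤ ∏ i, mvlen (M (σ i) i) := mvlen_prod_le _ _
      _ ≤ ∏ j, B j := Finset.prod_le_prod (fun i _ => mvlen_nonneg _) fun i _ => hM _ _
  calc ∑ σ : Equiv.Perm (Fin N), mvlen (((Equiv.Perm.sign σ : ℤ) : MvPolynomial (Fin n) ℤ) * ∏ i, M (σ i) i)
      ≤ ∑ _σ : Equiv.Perm (Fin N), ∏ j, B j := Finset.sum_le_sum fun σ _ => hσ σ
    _ = (Nat.factorial N : ℤ) * ∏ j, B j := by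
        rw [Finset.sum_const, Finset.card_univ, Fintype.card_perm, Fintype.card_fin, nsmul_eq_mul]

/-- Degree of a determinant whose `j`-th column has entries of total degree `≤ D j`: `≤ Σ D j`. -/
theorem totalDegree_det_le_cols {N : ℕ} (M : Matrix (Fin N) (Fin N) (MvPolynomial (Fin n) ℤ)) (D : Fin N → ℕ)
    (hM : ∀ i j, (M i j).totalDegree ≤ D j) : M.det.totalDegree ≤ ∑ j, D j := by
  rw [Matrix.det_apply']
  refine MvPolynomial.totalDegree_finsetSum_le fun σ _ => ?_
  rw [intCast_eq_C_RF]
  calc (MvPolynomial.C ((Equiv.Perm.sign σ : ℤˣ) : ℤ) * ∏ i, M (σ i) i).totalDegree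
      ≤ (MvPolynomial.C ((Equiv.Perm.sign σ : ℤˣ) : ℤ) : MvPolynomial (Fin n) ℤ).totalDegree +
          (∏ i, M (σ i) i).totalDegree := MvPolynomial.totalDegree_mul _ _
    _ = (∏ i, M (σ i) i).totalDegree := by rw [MvPolynomial.totalDegree_C, zero_add]
    _ ≤ ∑ i, (M (σ i) i).totalDegree := MvPolynomial.totalDegree_finsetProd _ _
    _ ≤ ∑ j, D j := Finset.sum_le_sum fun i _ => hM _ _

/-- Entries of the Sylvester matrix, column by column: the first `m` columns carry `g`-coefficients, the last `k`
columns carry `f`-coefficients. -/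
theorem sylvester_entry_le_cols (f g : Polynomial (MvPolynomial (Fin n) ℤ)) (m k : ℕ) {Bf Bg : ℤ} {Df Dg : ℕ}
    (hBf : 0 ≤ Bf) (hBg : 0 ≤ Bg) (hf : ∀ t, mvlen (f.coeff t) ≤ Bf ∧ (f.coeff t).totalDegree ≤ Df)
    (hg : ∀ t, mvlen (g.coeff t) ≤ Bg ∧ (g.coeff t).totalDegree ≤ Dg) (i j : Fin (m + k)) :
    mvlen (Polynomial.sylvester f g m k i j) ≤ Fin.addCases (fun _ => Bg) (fun _ => Bf) j ∧
      (Polynomial.sylvester f g m k i j).totalDegree ≤ Fin.addCases (fun _ => Dg) (fun _ => Df) j := by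
  unfold Polynomial.sylvester
  rw [Matrix.of_apply]
  induction j using Fin.addCases with
  | left j₁ =>
    rw [Fin.addCases_left, Fin.addCases_left, Fin.addCases_left]
    split_ifs
    · exact hg _
    · exact ⟨by rw [mvlen_zero]; exact hBg, by rw [MvPolynomial.totalDegree_zero]; exact Nat.zero_le _⟩
  | right j₁ =>
    rw [Fin.addCases_right, Fin.addCases_right, Fin.addCases_right]
    split_ifs
    · exact hf _
    · exact ⟨by rw [mvlen_zero]; exact hBf, by rw [MvPolynomial.totalDegree_zero]; exact Nat.zero_le _⟩

/-- **Length and degree of a resultant over `ℤ[x⃗]`, column-wise**: `len ≤ (m+k)!·Bg^m·Bf^k`, `deg ≤ m·Dg + k·Df`.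
(With `Bf = Bg = B`, `Df = Dg = D` this is exactly lens-6's uniform tree lemma `RootDecomp1KHyper.resultant_bounds`
— `(m+k)!·B^{m+k}` and `(m+k)·D`; the column-wise form is what the budget at degree `d·D` consumes: the `D₀ = deg_{X₀} P`
columns of CONSTANTS `≤ A` contribute `A^{D₀}` and degree `0`, the `d = deg f` columns of `P̂`-coefficients `L^d`
and degree `d·D`.) -/
theorem resultant_bounds_cols (f g : Polynomial (MvPolynomial (Fin n) ℤ)) (m k : ℕ) {Bf Bg : ℤ} {Df Dg : ℕ}
    (hBf : 0 ≤ Bf) (hBg : 0 ≤ Bg) (hf : ∀ t, mvlen (f.coeff t) ≤ Bf ∧ (f.coeff t).totalDegree ≤ Df)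
    (hg : ∀ t, mvlen (g.coeff t) ≤ Bg ∧ (g.coeff t).totalDegree ≤ Dg) :
    mvlen (Polynomial.resultant f g m k) ≤ (Nat.factorial (m + k) : ℤ) * (Bg ^ m * Bf ^ k) ∧
      (Polynomial.resultant f g m k).totalDegree ≤ m * Dg + k * Df := by
  unfold Polynomial.resultant
  constructor
  · have h := mvlen_det_le_cols _ (Fin.addCases (fun _ => Bg) (fun _ => Bf))
      fun i j => (sylvester_entry_le_cols f g m k hBf hBg hf hg i j).1
    refine h.trans (le_of_eq ?_)
    rw [Fin.prod_univ_add]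
    simp only [Fin.addCases_left, Fin.addCases_right, Finset.prod_const, Finset.card_univ, Fintype.card_fin]
  · have h := totalDegree_det_le_cols _ (Fin.addCases (fun _ => Dg) (fun _ => Df))
      fun i j => (sylvester_entry_le_cols f g m k hBf hBg hf hg i j).2
    refine h.trans (le_of_eq ?_)
    rw [Fin.sum_univ_add]
    simp only [Fin.addCases_left, Fin.addCases_right, Finset.sum_const, Finset.card_univ, Fintype.card_fin,
      smul_eq_mul]

end Leibniz

end Summit.Schanuel.Schanuel.Theorems.RootDecomp1BResFrame

end
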